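import Summits.ResolutionOfSingularities.ResolutionOfSingularities.Theorems.RadicialJungCleanModelsPBasisDerivation
import Summits.ResolutionOfSingularities.ResolutionOfSingularities.Theorems.RadicialJungCleanModelsPBasisMonomials
import HarnessLib

/-!
# Route `RadicialJung`, crux `CleanModels` (stmt-15917): the dual derivations of a `p`-basis
# (Giraud 1983 §1.4 "coordonnées différentielles" over an arbitrary field — step (P2) of
# `K2-DESIGN.md` §5.7)

Support file (OURS; general algebra in characteristic `p`) for PROGRAMME-clean-dim2 (T2, W8.1).
Giraud (Bull. SMF 111 (1983), 1.4) works with differential coordinates `(x_1, …, x_n)` of a regular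
scheme with `Ω¹` free of finite rank and the partial derivatives `∂/∂x_i`; over a NON-`F`-finite
ground field `Ω¹` is not of finite rank and the substitute is a `p`-basis `Γ` of the local ring `R`
over `R^p` (Kimura–Niitsuma 1980, Thm. 3.4; typed `Literature/RingTheory/PBasis/`, possibly
infinite). Here, for ANY commutative ring `R` of characteristic `p` and `Γ ⊆ R` with
`IsPBasisOver p R^p Γ`:

* `IsPBasisOver.exists_monomialBasis` — the reduced monomials `Γ^b` form an `R^p`-basis of `R`
  (`Basis.mk` on `linearIndependent_monomial` / `span_monomial_eq_top` of
  `RadicialJungCleanModelsPBasisMonomials.lean`);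
* `IsPBasisOver.exists_dual_derivation`, `IsPBasisOver.exists_dual_derivations` — **for every
  `γ ∈ Γ` there is a derivation `∂_γ ∈ Der_ℤ(R)` with `∂_γ γ = 1` and `∂_γ γ′ = 0` for the other
  `γ′ ∈ Γ`**: the `R^p`-linear map `Γ^b ↦ (b γ) Γ^{b − e_γ}` on the monomial basis satisfies
  `∂_γ(Γ^b) = (b γ) Γ^{b−e_γ}` for ALL exponents `b` (write `b = p·q + ρ`, `Γ^b = (Γ^q)^p Γ^ρ`)
  and hence the Leibniz rule on pairs of basis vectors;
* `derivation_apply_eq_sum_mul_dual` — every derivation `D` is, on a given `f`, a finite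
  combination `D f = Σ_{γ ∈ F} D(γ) ∂_γ f` (`F` = the coordinates occurring in the expansion of
  `f`); hence `span_nullDerivation_apply_eq_span_dual` — **`{D f : D x = D y = 0}` and
  `{∂_γ f : γ ∈ Γ ∖ {x, y}}` span the same ideal** (Giraud's `(f′_{u_i})`, the ideal `N(R, f; x, y)`
  of `RadicialJungCleanModelsLogContentIdeal*.lean`).

References: J. Giraud, Bull. SMF 111 (1983), 1.4 [Giraud1983]; T. Kimura, H. Niitsuma, J. Math.
Soc. Japan 32 (1980), p. 363 [KimuraNiitsuma1980]; H. Matsumura, Commutative Ring Theory, §26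
(`p`-bases are differential bases) [Matsumura1987]. Nothing here is a statement of Hironaka's
manuscript or bears on the summit directly.
-/

noncomputable section

set_option linter.dupNamespace false -- mandated namespace of this single-conjunct summit

open Literature.RingTheory.PBasis

namespace Summit.ResolutionOfSingularities.ResolutionOfSingularities.Theorems.RadicialJung.CleanModels

universe u

variable {p : ℕ} {R : Type u} [CommRing R] {Γ : Set R}

/-! ## Monomial arithmetic -/

/-- `Γ^{b₁ + b₂} = Γ^{b₁} Γ^{b₂}`. [folklore] -/
theorem monomial_add (b₁ b₂ : Γ →₀ ℕ) :
    ((b₁ + b₂).prod fun γ n => ((γ : Γ) : R) ^ n) =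
      (b₁.prod fun γ n => ((γ : Γ) : R) ^ n) * b₂.prod fun γ n => ((γ : Γ) : R) ^ n :=
  Finsupp.prod_add_index' (h := fun (γ : Γ) (n : ℕ) => ((γ : Γ) : R) ^ n)
    (fun _ => pow_zero _) (fun _ _ _ => pow_add _ _ _)

/-- `Γ^{e_γ} = γ`. [folklore] -/
theorem monomial_single_one (γ : Γ) :
    ((Finsupp.single γ 1).prod fun γ n => ((γ : Γ) : R) ^ n) = (γ : R) := by
  rw [Finsupp.prod_single_index (h := fun (γ : Γ) (n : ℕ) => ((γ : Γ) : R) ^ n) (pow_zero _),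
    pow_one]

/-- **`Γ^b = (Γ^q)^p · Γ^r` when `b = p q + r` coordinatewise.** [folklore] -/
theorem monomial_eq_pow_mul_of_eq (b q r : Γ →₀ ℕ) (h : ∀ γ, b γ = p * q γ + r γ) :
    (b.prod fun γ n => ((γ : Γ) : R) ^ n) =
      (q.prod fun γ n => ((γ : Γ) : R) ^ n) ^ p * r.prod fun γ n => ((γ : Γ) : R) ^ n := by
  classical
  have hb : b = Finsupp.mapRange (fun n => p * n) (mul_zero p) q + r := by
    ext γ
    rw [Finsupp.add_apply, Finsupp.mapRange_apply, h]
  rw [hb, monomial_add, Finsupp.prod_mapRange_index (fun _ => pow_zero _)]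
  congr 1
  unfold Finsupp.prod
  rw [← Finset.prod_pow]
  exact Finset.prod_congr rfl fun γ _ => pow_mul' _ _ _

/-- In characteristic `p`: `(b γ : R) = (r γ : R)` when `b = p q + r`. [folklore] -/
theorem natCast_apply_eq_of_eq [CharP R p] (b q r : Γ →₀ ℕ) (h : ∀ γ, b γ = p * q γ + r γ)
    (γ : Γ) : ((b γ : ℕ) : R) = ((r γ : ℕ) : R) := by
  rw [h γ, Nat.cast_add, Nat.cast_mul, CharP.cast_eq_zero R p, zero_mul, zero_add]

omit [CommRing R] in
/-- Every exponent decomposes as `b = p q + ρ` with `ρ` reduced (`p ≠ 0`). [folklore] -/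
theorem exists_eq_mul_add_reduced (hp : p ≠ 0) (b : Γ →₀ ℕ) :
    ∃ (q : Γ →₀ ℕ) (ρ : {b : Γ →₀ ℕ // ∀ γ, b γ < p}), ∀ γ, b γ = p * q γ + ρ.1 γ := by
  classical
  refine ⟨Finsupp.mapRange (fun n => n / p) (Nat.zero_div p) b,
    ⟨Finsupp.mapRange (fun n => n % p) (Nat.zero_mod p) b, fun γ => ?_⟩, fun γ => ?_⟩
  · rw [Finsupp.mapRange_apply]; exact Nat.mod_lt _ (Nat.pos_of_ne_zero hp)
  · simp only [Finsupp.mapRange_apply]; exact (Nat.div_add_mod (b γ) p).symm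

omit [CommRing R] in
/-- `b₂ + (b − e_γ) = (b₂ + b) − e_γ` when `b γ ≥ 1`. [folklore] -/
theorem add_tsub_single_eq {b : Γ →₀ ℕ} {γ : Γ} (hb : b γ ≠ 0) (b₂ : Γ →₀ ℕ) :
    b₂ + (b - Finsupp.single γ 1) = (b₂ + b) - Finsupp.single γ 1 := by
  classical
  ext γ'
  simp only [Finsupp.add_apply, Finsupp.tsub_apply, Finsupp.single_apply]
  split_ifs with h
  · subst h; omega
  · omega

/-! ## The monomial basis and the dual derivations -/

variable [Fact p.Prime] [CharP R p]

/-- **The reduced monomials form an `R^p`-basis of `R`.** [cite: KimuraNiitsuma1980, p. 363] -/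
theorem IsPBasisOver.exists_monomialBasis (h : IsPBasisOver p (frobenius R p).range Γ) :
    ∃ B : Module.Basis {b : Γ →₀ ℕ // ∀ γ, b γ < p} (frobenius R p).range R,
      ∀ b, B b = (b.1).prod fun γ n => ((γ : Γ) : R) ^ n :=
  ⟨Module.Basis.mk (IsPBasisOver.linearIndependent_monomial h)
    (by rw [IsPBasisOver.span_monomial_eq_top h]), fun b => Module.Basis.mk_apply _ _ b⟩

/-- **Dual derivations of a `p`-basis.** For `IsPBasisOver p R^p Γ` and `γ ∈ Γ` there is a
derivation `∂_γ` of `R` with `∂_γ γ = 1` and `∂_γ γ′ = 0` for every other `γ′ ∈ Γ` — the partial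
derivative along the coordinate `γ`: on the monomial basis, `∂_γ(c Γ^b) = c (b γ) Γ^{b − e_γ}`
(`c ∈ R^p`). (Giraud 1983, 1.4: the `∂f/∂x_i` of a system of differential coordinates; over an
arbitrary field via Kimura–Niitsuma's `p`-basis.) [cite: Giraud1983, 1.4] -/
theorem IsPBasisOver.exists_dual_derivation (h : IsPBasisOver p (frobenius R p).range Γ) (γ : Γ) :
    ∃ D : Derivation ℤ R R, D (γ : R) = 1 ∧ ∀ γ' : Γ, γ' ≠ γ → D (γ' : R) = 0 := by
  classical
  have hp : p.Prime := Fact.out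
  set R' := (frobenius R p).range with hR'
  obtain ⟨B, hB⟩ := IsPBasisOver.exists_monomialBasis h
  -- the `R^p`-linear map `Γ^b ↦ (b γ) Γ^{b - e_γ}` on the basis
  let E : R →ₗ[R'] R := B.constr R' fun b =>
    ((b.1 γ : ℕ) : R) * (b.1 - Finsupp.single γ 1).prod fun γ n => ((γ : Γ) : R) ^ n
  have hEb : ∀ b : {b : Γ →₀ ℕ // ∀ γ, b γ < p}, E ((b.1).prod fun γ n => ((γ : Γ) : R) ^ n) =
      ((b.1 γ : ℕ) : R) * (b.1 - Finsupp.single γ 1).prod fun γ n => ((γ : Γ) : R) ^ n := by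
    intro b
    have := B.constr_basis R' (fun b => ((b.1 γ : ℕ) : R) *
      (b.1 - Finsupp.single γ 1).prod fun γ n => ((γ : Γ) : R) ^ n) b
    rwa [hB b] at this
  have hEsmul : ∀ (a : R), a ∈ R' → ∀ m : R, E (a * m) = a * E m :=
    fun a ha m => LinearMap.map_smul E ⟨a, ha⟩ m
  -- KEY: `E(Γ^b) = (b γ) Γ^{b − e_γ}` for EVERY exponent `b`
  have hEmon : ∀ b : Γ →₀ ℕ, E (b.prod fun γ n => ((γ : Γ) : R) ^ n) =
      ((b γ : ℕ) : R) * (b - Finsupp.single γ 1).prod fun γ n => ((γ : Γ) : R) ^ n := by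
    intro b
    obtain ⟨q, ρ, hqρ⟩ := exists_eq_mul_add_reduced (Γ := Γ) hp.ne_zero b
    have hqp : (q.prod fun γ n => ((γ : Γ) : R) ^ n) ^ p ∈ R' := ⟨_, frobenius_def ..⟩
    rw [monomial_eq_pow_mul_of_eq b q ρ.1 hqρ, hEsmul _ hqp, hEb ρ,
      natCast_apply_eq_of_eq b q ρ.1 hqρ γ]
    by_cases hρ : ρ.1 γ = 0
    · rw [hρ, Nat.cast_zero, zero_mul, mul_zero, zero_mul]
    · have hqρ' : ∀ γ', (b - Finsupp.single γ 1 : Γ →₀ ℕ) γ' =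
          p * q γ' + (ρ.1 - Finsupp.single γ 1 : Γ →₀ ℕ) γ' := by
        intro γ'
        simp only [Finsupp.tsub_apply, Finsupp.single_apply]
        split_ifs with hγ'
        · subst hγ'; have := hqρ γ; omega
        · rw [Nat.sub_zero, Nat.sub_zero]; exact hqρ γ'
      rw [monomial_eq_pow_mul_of_eq _ q _ hqρ']
      ring
  -- Leibniz on pairs of monomials
  have hEmul : ∀ b₁ b₂ : Γ →₀ ℕ,
      E ((b₁.prod fun γ n => ((γ : Γ) : R) ^ n) * b₂.prod fun γ n => ((γ : Γ) : R) ^ n) =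
        (b₁.prod fun γ n => ((γ : Γ) : R) ^ n) * E (b₂.prod fun γ n => ((γ : Γ) : R) ^ n) +
          (b₂.prod fun γ n => ((γ : Γ) : R) ^ n) * E (b₁.prod fun γ n => ((γ : Γ) : R) ^ n) := by
    intro b₁ b₂
    rw [← monomial_add, hEmon, hEmon, hEmon, Finsupp.add_apply, Nat.cast_add]
    have h2 : ((b₂ γ : ℕ) : R) * ((b₁.prod fun γ n => ((γ : Γ) : R) ^ n) *
        (b₂ - Finsupp.single γ 1).prod fun γ n => ((γ : Γ) : R) ^ n) =
        ((b₂ γ : ℕ) : R) * (b₁ + b₂ - Finsupp.single γ 1).prod fun γ n => ((γ : Γ) : R) ^ n := by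
      by_cases hb : b₂ γ = 0
      · rw [hb, Nat.cast_zero, zero_mul, zero_mul]
      · rw [← monomial_add, add_tsub_single_eq hb]
    have h1 : ((b₁ γ : ℕ) : R) * ((b₂.prod fun γ n => ((γ : Γ) : R) ^ n) *
        (b₁ - Finsupp.single γ 1).prod fun γ n => ((γ : Γ) : R) ^ n) =
        ((b₁ γ : ℕ) : R) * (b₁ + b₂ - Finsupp.single γ 1).prod fun γ n => ((γ : Γ) : R) ^ n := by
      by_cases hb : b₁ γ = 0
      · rw [hb, Nat.cast_zero, zero_mul, zero_mul]
      · rw [← monomial_add, add_tsub_single_eq hb, add_comm b₂ b₁]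
    calc (((b₁ γ : ℕ) : R) + ((b₂ γ : ℕ) : R)) *
          (b₁ + b₂ - Finsupp.single γ 1).prod (fun γ n => ((γ : Γ) : R) ^ n)
        = ((b₂ γ : ℕ) : R) * (b₁ + b₂ - Finsupp.single γ 1).prod (fun γ n => ((γ : Γ) : R) ^ n) +
            ((b₁ γ : ℕ) : R) * (b₁ + b₂ - Finsupp.single γ 1).prod (fun γ n => ((γ : Γ) : R) ^ n) := by
          ring
      _ = ((b₂ γ : ℕ) : R) * ((b₁.prod fun γ n => ((γ : Γ) : R) ^ n) *
              (b₂ - Finsupp.single γ 1).prod fun γ n => ((γ : Γ) : R) ^ n) +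
            ((b₁ γ : ℕ) : R) * ((b₂.prod fun γ n => ((γ : Γ) : R) ^ n) *
              (b₁ - Finsupp.single γ 1).prod fun γ n => ((γ : Γ) : R) ^ n) := by rw [h1, h2]
      _ = _ := by ring
  -- Leibniz in general, by bilinearity on the monomial basis
  have hLeib : ∀ f g : R, E (f * g) = f * E g + g * E f := by
    let L₁ : R →ₗ[R'] R →ₗ[R'] R := (LinearMap.mul R' R).compr₂ E
    let L₂ : R →ₗ[R'] R →ₗ[R'] R :=
      (LinearMap.mul R' R).compl₂ E + (LinearMap.mul R' R).flip ∘ₗ E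
    have hL : L₁ = L₂ := by
      refine B.ext fun b₁ => B.ext fun b₂ => ?_
      simp only [L₁, L₂, LinearMap.compr₂_apply, LinearMap.add_apply, LinearMap.compl₂_apply,
        LinearMap.comp_apply, LinearMap.flip_apply, LinearMap.mul_apply', hB]
      exact hEmul b₁.1 b₂.1
    intro f g
    have := congrArg (fun L : R →ₗ[R'] R →ₗ[R'] R => L f g) hL
    simp only [L₁, L₂, LinearMap.compr₂_apply, LinearMap.add_apply, LinearMap.compl₂_apply,
      LinearMap.comp_apply, LinearMap.flip_apply, LinearMap.mul_apply'] at this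
    exact this
  have hE1 : E 1 = 0 := by simpa using hEmon 0
  -- the derivation
  let D : Derivation ℤ R R :=
    { toFun := E
      map_add' := fun a b => map_add E a b
      map_smul' := fun n a => by rw [RingHom.id_apply]; exact map_zsmul E n a
      map_one_eq_zero' := hE1
      leibniz' := fun f g => by
        change E (f * g) = f • E g + g • E f
        rw [hLeib, smul_eq_mul, smul_eq_mul] }
  refine ⟨D, ?_, fun γ' hne => ?_⟩
  · change E (γ : R) = 1
    rw [← monomial_single_one γ, hEmon, Finsupp.single_eq_same, Nat.cast_one, one_mul,
      tsub_self, Finsupp.prod_zero_index]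
  · change E (γ' : R) = 0
    rw [← monomial_single_one γ', hEmon, Finsupp.single_eq_of_ne (Ne.symm hne), Nat.cast_zero,
      zero_mul]

/-- **A family of dual derivations** `δ_γ` (`γ ∈ Γ`): `δ_γ γ = 1`, `δ_γ γ′ = 0` for `γ′ ≠ γ`.
[cite: Giraud1983, 1.4] -/
theorem IsPBasisOver.exists_dual_derivations (h : IsPBasisOver p (frobenius R p).range Γ) :
    ∃ δ : Γ → Derivation ℤ R R, (∀ γ : Γ, δ γ (γ : R) = 1) ∧
      ∀ γ γ' : Γ, γ' ≠ γ → δ γ (γ' : R) = 0 := by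
  choose δ h₁ h₂ using fun γ => IsPBasisOver.exists_dual_derivation h γ
  exact ⟨δ, h₁, h₂⟩

/-! ## Every derivation is a finite combination of the dual derivations on a given element -/

section Combination

variable (δ : Γ → Derivation ℤ R R) (hδ₁ : ∀ γ : Γ, δ γ (γ : R) = 1)
  (hδ₀ : ∀ γ γ' : Γ, γ' ≠ γ → δ γ (γ' : R) = 0)

omit [Fact p.Prime] [CharP R p] in
/-- Evaluation of a finite sum of scaled derivations. [folklore] -/
theorem sum_smul_derivation_apply (F : Finset Γ) (a : Γ → R) (r : R) :
    (∑ γ ∈ F, a γ • δ γ) r = ∑ γ ∈ F, a γ * δ γ r := by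
  rw [← Derivation.coeFnAddMonoidHom_apply, map_sum, Finset.sum_apply]
  refine Finset.sum_congr rfl fun γ _ => ?_
  rw [Derivation.coeFnAddMonoidHom_apply, Derivation.smul_apply, smul_eq_mul]

include hδ₁ hδ₀ in
/-- **`D f = Σ_{γ ∈ F} D(γ) · δ_γ f`** for every derivation `D`, where `F` is the finite set of
coordinates occurring in the expansion of `f` along the `p`-basis (the derivation
`D − Σ_F D(γ) δ_γ` kills `R^p` and the `γ ∈ F`, hence the monomials of `f`). [cite: Giraud1983, 1.4] -/
theorem derivation_apply_eq_sum_mul_dual (h : IsPBasisOver p (frobenius R p).range Γ) (f : R) :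
    ∃ F : Finset Γ, ∀ D : Derivation ℤ R R, D f = ∑ γ ∈ F, D (γ : R) * δ γ f := by
  classical
  obtain ⟨c, hc⟩ := IsPBasisOver.exists_monomial_expansion h f
  refine ⟨c.support.biUnion fun b => b.1.support, fun D => ?_⟩
  set F := c.support.biUnion fun b => b.1.support with hF
  -- the corrected derivation
  let D' : Derivation ℤ R R := D - ∑ γ ∈ F, (D (γ : R)) • δ γ
  have hD'apply : ∀ r : R, D' r = D r - ∑ γ ∈ F, D (γ : R) * δ γ r := by
    intro r
    simp only [D', Derivation.sub_apply, sum_smul_derivation_apply]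
  have hD'γ : ∀ γ ∈ F, D' (γ : R) = 0 := by
    intro γ hγ
    rw [hD'apply, Finset.sum_eq_single γ
      (fun γ' _ hne => by rw [hδ₀ γ' γ (Ne.symm hne), mul_zero]) (fun hn => (hn hγ).elim),
      hδ₁, mul_one, sub_self]
  -- it kills every monomial of `f`, hence `f`
  have hD'f : D' f = 0 := by
    rw [← hc]
    unfold Finsupp.sum
    rw [map_sum]
    refine Finset.sum_eq_zero fun b hb => ?_
    rw [derivation_frobenius_mul, derivation_finsupp_prod_eq_zero D' (fun γ : Γ => ((γ : Γ) : R))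
      b.1 (fun γ hγ => hD'γ γ (Finset.mem_biUnion.mpr ⟨b, hb, hγ⟩)), mul_zero]
  have := hD'apply f
  rw [hD'f] at this
  exact sub_eq_zero.mp this.symm

variable {x y : R} (hx : x ∈ Γ) (hy : y ∈ Γ)

include hδ₁ hδ₀ hx hy in
/-- **`N(R, f; x, y) = (δ_u f : u ∈ Γ ∖ {x, y})`**: the values `D f` of the derivations killing
`x` and `y` and the values `δ_u f` of the dual derivations of the other coordinates span the same
ideal (Giraud's `(f′_{u_1}, …, f′_{u_k})`). [cite: Giraud1983, 1.1 (3) and 2.6] -/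
theorem span_nullDerivation_apply_eq_span_dual (h : IsPBasisOver p (frobenius R p).range Γ)
    (f : R) :
    Ideal.span {v : R | ∃ D : Derivation ℤ R R, D x = 0 ∧ D y = 0 ∧ D f = v} =
      Ideal.span {v : R | ∃ γ : Γ, (γ : R) ≠ x ∧ (γ : R) ≠ y ∧ δ γ f = v} := by
  classical
  apply le_antisymm
  · rw [Ideal.span_le]
    rintro _ ⟨D, hDx, hDy, rfl⟩
    obtain ⟨F, hF⟩ := derivation_apply_eq_sum_mul_dual δ hδ₁ hδ₀ h f
    rw [SetLike.mem_coe, hF D]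
    refine Ideal.sum_mem _ fun γ _ => ?_
    by_cases hγx : (γ : R) = x
    · rw [hγx, hDx, zero_mul]; exact Ideal.zero_mem _
    by_cases hγy : (γ : R) = y
    · rw [hγy, hDy, zero_mul]; exact Ideal.zero_mem _
    exact Ideal.mul_mem_left _ _ (Ideal.subset_span ⟨γ, hγx, hγy, rfl⟩)
  · apply Ideal.span_mono
    rintro _ ⟨γ, hγx, hγy, rfl⟩
    exact ⟨δ γ, hδ₀ γ ⟨x, hx⟩ (fun e => hγx (by rw [← e])),
      hδ₀ γ ⟨y, hy⟩ (fun e => hγy (by rw [← e])), rfl⟩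

end Combination

end Summit.ResolutionOfSingularities.ResolutionOfSingularities.Theorems.RadicialJung.CleanModels

end
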